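import Literature.Computability.MetaComplexity.UniversalMachineProofs
import Literature.Computability.Complexity.FoldBricks
import Literature.Computability.Complexity.UnaryOffsets
import Literature.Computability.Complexity.PRelHierarchy
import HarnessLib

/-!
# A padded universal machine: an s-m-n mode handing a program its parameter and two clocks

Companion of `UniversalMachine.lean` / `UniversalMachineProofs.lean`, written for the Chen–Flum
construction of an effectively P-bounded logic for PTIME from a p-optimal proof system for `TAUT`
(`ModelTheory/FiniteModelTheory/POptimalAndLogicsForPTIMEProofs.lean`, Chen–Flum 2010, Cor. 10
and Prop. 11). There, the evaluation program of a sentence `ψ` of the time-clocked logic must run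
ONE fixed machine on `(ψ, ⌜G⌝)` with time polynomial in `|⌜G⌝|` of a degree read off `ψ` — an
s-m-n instance with a sentence-dependent clock. The abstract `UniversalMachine` (programs
`boolPair e w`, field `sim`) offers neither currying nor clocks to the simulated machine, and the
conclusion of Cor. 10 in the tree quantifies `∃ U : UniversalMachine`; this file builds, from ANY
universal machine `U₀`, a universal machine `padUM U₀` with an additional **padded s-m-n mode**:

* program `0 :: e` on input `w`: `U₀`'s program `⟨e, w⟩` (whence `sim`, and `print` by
  `UniversalMachine.print_of_sim`);
* program `1 :: ⟨e₀, ψ⟩` on input `w` with budget `t`: with `L₁ = |ψ.1|`, `L₂ = |ψ.2.1|` (unary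
  fields of the parameter) and the clocks `Bᵢ = (|w| + 2)^{Lᵢ}`: no output while `t < B₁ + B₂`, and
  `U₀`'s output on the program `⟨e₀, ⟨ψ, ⟨w, ⟨1^{B₁}, 1^{B₂}⟩⟩⟩⟩` with budget `t` afterwards
  (`padRun_smn`). The threshold makes the run monotone in `t` although the simulated machine is
  handed the clocks (Arora–Barak 2009, §1.4.1: clocked simulation; Thm. 1.9: efficient universal
  machine; the s-m-n theorem, Rogers 1967 §1.8 / Soare 1987 I.3.5, in its polynomial-time form).

The polynomial-time field is assembled in the `FP` string algebra (`BrickAlgebra.lean`): the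
clocked run of `U₀` as a string function (`urunFn`, from `U₀.polyTime` by `mem_FP_of_unaryArg`), and
the **capped power** `powCapFn ⟨u, ⟨b, c⟩⟩ = 1^{min (|c|, |b|^{|u|})}` (`|u|` rounds of the unary
product `UnaryOffsets.mulLenFn` truncated to `|c|`, `iterate_mem_FP_of_poly`), by which the padded
machine compares `B₁ + B₂` with its own unary budget without ever writing an over-long string.

## References

* S. Arora, B. Barak, *Computational Complexity: A Modern Approach*, CUP 2009, Thm. 1.9, §1.4.1.
* H. Rogers, *Theory of Recursive Functions and Effective Computability*, McGraw-Hill 1967, §1.8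
  (s-m-n theorem).
* Y. Chen, J. Flum, *On p-optimal proof systems and logics for PTIME*, ICALP 2010, Prop. 11.
-/

noncomputable section

namespace Literature.Computability.MetaComplexity

open _root_.Computability Polynomial Complexity Complexity.Brick Complexity.Plumb

namespace PaddedUM

/-! ### The clocked run of a universal machine as a string function -/

/-- The option-of-string output code of `UniversalMachine.polyTime`:
`none ↦ [0]`, `some y ↦ 1 :: y`. [folklore] -/
def encOpt (o : Option (List Bool)) : List Bool := ((encodingList Bool).optionBool).encode o

/-- `encOpt none = [0]`. [folklore] -/
@[simp] theorem encOpt_none : encOpt none = [false] := rfl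

/-- `encOpt (some y) = 1 :: y`. [folklore] -/
@[simp] theorem encOpt_some (y : List Bool) : encOpt (some y) = true :: y := rfl

/-- **The clocked run as a string function**: `urunFn U₀ ⟨prog, u⟩ = encOpt (U₀.run prog |u|)`.
[cite: AroraBarak2009, Thm. 1.9 and §1.4.1] -/
def urunFn (U₀ : UniversalMachine) (z : List Bool) : List Bool :=
  encOpt (U₀.run (boolUnpair z).1 (boolUnpair z).2.length)

/-- Value of `urunFn` on a pair. [folklore] -/
@[simp] theorem urunFn_boolPair (U₀ : UniversalMachine) (prog u : List Bool) :
    urunFn U₀ (boolPair prog u) = encOpt (U₀.run prog u.length) := by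
  simp [urunFn]

/-- **`urunFn U₀ ∈ FP`** (the field `polyTime`, through `mem_FP_of_unaryArg`).
[cite: AroraBarak2009, Thm. 1.9 and §1.4.1] -/
theorem urunFn_mem_FP (U₀ : UniversalMachine) : urunFn U₀ ∈ FP :=
  mem_FP_of_unaryArg U₀.polyTime

/-! ### The capped power -/

/-- `min c (min c (b^k) * b) = min c (b^(k+1))`: capping commutes with one more factor.
[folklore] -/
theorem min_mul_step (c b k : ℕ) : min c (min c (b ^ k) * b) = min c (b ^ (k + 1)) := by
  rcases Nat.eq_zero_or_pos b with rfl | hb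
  · cases k <;> simp
  rcases le_total c (b ^ k) with h | h
  · rw [min_eq_left h]
    have h1 : c ≤ c * b := Nat.le_mul_of_pos_right _ hb
    have h2 : c ≤ b ^ (k + 1) := h.trans (Nat.pow_le_pow_right hb (Nat.le_succ k))
    rw [min_eq_left h1, min_eq_left h2]
  · rw [min_eq_right h, pow_succ]

/-- One round of the capped power on records `⟨u, ⟨b, ⟨c, acc⟩⟩⟩`:
`acc := (b^{|acc|}) ↾ |c|` (a string of length `min |c| (|acc|·|b|)`). [folklore] -/
def powStep : List Bool → List Bool :=
  fanoutFn fstF (fanoutFn (nthF 1) (fanoutFn (nthF 2)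
    (takeFn ∘ fanoutFn (nthF 2) (UnaryOffsets.mulLenFn ∘ fanoutFn (sndPow 2) (nthF 1)))))

/-- `powStep ∈ FP`. [cite: AroraBarak2009, §1.3] -/
theorem powStep_mem_FP : powStep ∈ FP :=
  fanoutFn_mem_FP fstF_mem_FP (fanoutFn_mem_FP (nthF_mem_FP 1) (fanoutFn_mem_FP (nthF_mem_FP 2)
    (comp_mem_FP takeFn_mem_FP (fanoutFn_mem_FP (nthF_mem_FP 2)
      (comp_mem_FP UnaryOffsets.mulLenFn_mem_FP (fanoutFn_mem_FP (sndPow_mem_FP 2) (nthF_mem_FP 1)))))))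

/-- `powStep` on an arbitrary string: a record on the first three fields with a short last field.
[folklore] -/
theorem powStep_apply (z : List Bool) :
    powStep z = boolPair (fstF z) (boolPair (nthF 1 z) (boolPair (nthF 2 z)
      ((UnaryOffsets.mulLenFn (boolPair (sndPow 2 z) (nthF 1 z))).take (nthF 2 z).length))) := by
  simp [powStep]

/-- `powStep` on a record. [folklore] -/
theorem powStep_rec (u b c acc : List Bool) :
    powStep (boolPair u (boolPair b (boolPair c acc))) =
      boolPair u (boolPair b (boolPair c
        ((UnaryOffsets.mulLenFn (boolPair acc b)).take c.length))) := by
  rw [powStep_apply]; simp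

/-- Iterates of `powStep` on a record with unary fields, started from the accumulator `1ᶜ ↾ 1`:
after `k` rounds the last field is `1^{min c (b^k)}`. [folklore] -/
theorem iterate_powStep_rec (u : List Bool) (b c k : ℕ) :
    powStep^[k] (boolPair u (boolPair (ones b) (boolPair (ones c) ((ones c).take 1)))) =
      boolPair u (boolPair (ones b) (boolPair (ones c) (ones (min c (b ^ k))))) := by
  induction k with
  | zero =>
    simp only [Function.iterate_zero, id_eq, pow_zero]
    congr 3
    simp [ones, List.take_replicate, Nat.min_comm]
  | succ k ih =>
    rw [Function.iterate_succ_apply', ih, powStep_rec, UnaryOffsets.mulLenFn_boolPair]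
    congr 3
    simp only [ones, List.length_replicate]
    rw [show (List.replicate (min c (b ^ k)) (List.replicate b true)).flatten =
        List.replicate (min c (b ^ k) * b) true by
      simp [List.flatten_replicate_replicate] ]
    rw [List.take_replicate, min_mul_step]

/-- Size of the iterates of `powStep` on an arbitrary string: linear. [folklore] -/
theorem length_iterate_powStep_le (z : List Bool) (n : ℕ) :
    (powStep^[n] z).length ≤ (7 * X + 6 : Polynomial ℕ).eval (z.length + n) := by
  simp only [eval_add, eval_mul, eval_ofNat, eval_X]
  rcases n with _ | n
  · simp; omega
  · rw [Function.iterate_succ_apply']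
    set y := powStep^[n] z with hy
    -- the first three fields are preserved by every round, so they are those of `z`
    have hfields : fstF y = fstF z ∧ nthF 1 y = nthF 1 z ∧ nthF 2 y = nthF 2 z := by
      rw [hy]; clear hy y
      induction n with
      | zero => simp
      | succ n ih =>
        rw [Function.iterate_succ_apply', powStep_apply]
        simp [ih.1, ih.2.1, ih.2.2]
    rw [powStep_apply, hfields.1, hfields.2.1, hfields.2.2]
    simp only [length_boolPair, List.length_take]
    have h0 := length_nthF_le 0 z
    have h1 := length_nthF_le 1 z
    have h2 := length_nthF_le 2 z
    simp only [nthF_zero] at h0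
    have h3 : min (nthF 2 z).length (UnaryOffsets.mulLenFn (boolPair (sndPow 2 y) (nthF 1 z))).length
        ≤ z.length := (min_le_left _ _).trans h2
    omega

/-- The record `⟨u, ⟨b, ⟨c, c ↾ 1⟩⟩⟩` from `⟨u, ⟨b, c⟩⟩`. [folklore] -/
def powInit : List Bool → List Bool :=
  fanoutFn fstF (fanoutFn (nthF 1) (fanoutFn (sndPow 1) (Complexity.take1Fn ∘ sndPow 1)))

/-- `powInit ∈ FP`. [cite: AroraBarak2009, §1.3] -/
theorem powInit_mem_FP : powInit ∈ FP :=
  fanoutFn_mem_FP fstF_mem_FP (fanoutFn_mem_FP (nthF_mem_FP 1) (fanoutFn_mem_FP (sndPow_mem_FP 1)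
    (comp_mem_FP Complexity.take1Fn_mem_FP (sndPow_mem_FP 1))))

/-- `powInit` on a record. [folklore] -/
@[simp] theorem powInit_rec (u b c : List Bool) :
    powInit (boolPair u (boolPair b c)) = boolPair u (boolPair b (boolPair c (c.take 1))) := by
  simp [powInit, Complexity.take1Fn]

/-- **The capped power** `powCapFn ⟨u, ⟨1ᵇ, 1ᶜ⟩⟩ = 1^{min c (b^{|u|})}`: `|u|` rounds of `powStep`
from `powInit`, then the last field. [cite: AroraBarak2009, §1.3 (bounded loops)] -/
def powCapFn : List Bool → List Bool :=
  sndPow 2 ∘ (fun z => powStep^[(X : Polynomial ℕ).eval (boolUnpair z).1.length] z) ∘ powInit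

/-- **`powCapFn ∈ FP`.** [cite: AroraBarak2009, §1.3 (bounded loops), §1.4.1] -/
theorem powCapFn_mem_FP : powCapFn ∈ FP :=
  comp_mem_FP (sndPow_mem_FP 2) (comp_mem_FP
    (iterate_mem_FP_of_poly powStep_mem_FP (7 * X + 6) length_iterate_powStep_le X) powInit_mem_FP)

/-- **Semantics of the capped power.** [folklore] -/
theorem powCapFn_apply (u : List Bool) (b c : ℕ) :
    powCapFn (boolPair u (boolPair (ones b) (ones c))) = ones (min c (b ^ u.length)) := by
  simp only [powCapFn, Function.comp_apply, powInit_rec, boolUnpair_boolPair, eval_X,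
    iterate_powStep_rec]
  simp

/-- The capped power is at most the cap. [folklore] -/
theorem length_powCapFn_apply_le (u : List Bool) (b c : ℕ) :
    (powCapFn (boolPair u (boolPair (ones b) (ones c)))).length ≤ c := by
  rw [powCapFn_apply]; simp

/-! ### The padded s-m-n run -/

variable (U₀ : UniversalMachine)

/-- The two clocks of the s-m-n mode: `(|w| + 2)^{|ψ.1|}` and `(|w| + 2)^{|ψ.2.1|}`. [folklore] -/
def clock₁ (ψ w : List Bool) : ℕ := (w.length + 2) ^ (boolUnpair ψ).1.length

/-- See `clock₁`. [folklore] -/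
def clock₂ (ψ w : List Bool) : ℕ := (w.length + 2) ^ (boolUnpair (boolUnpair ψ).2).1.length

/-- The `U₀`-program of the s-m-n mode: `⟨e₀, ⟨ψ, ⟨w, ⟨1^{B₁}, 1^{B₂}⟩⟩⟩⟩`. [folklore] -/
def smnProg (e₀ ψ w : List Bool) : List Bool :=
  boolPair e₀ (boolPair ψ (boolPair w (boolPair (ones (clock₁ ψ w)) (ones (clock₂ ψ w)))))

/-- **The padded run.** On a program `q = ⟨e, w⟩` (total decoding `boolUnpair`):
if `e = 1 :: ⟨e₀, ψ⟩`, no output while `t < B₁ + B₂` and `U₀.run (smnProg e₀ ψ w) t` afterwards;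
otherwise `U₀.run ⟨e.tail, w⟩ t`. [cite: AroraBarak2009, Thm. 1.9 and §1.4.1] -/
def padRun (q : List Bool) (t : ℕ) : Option (List Bool) :=
  if (boolUnpair q).1.take 1 = [true] then
    if clock₁ (boolUnpair (boolUnpair q).1.tail).2 (boolUnpair q).2 +
        clock₂ (boolUnpair (boolUnpair q).1.tail).2 (boolUnpair q).2 ≤ t then
      U₀.run (smnProg (boolUnpair (boolUnpair q).1.tail).1 (boolUnpair (boolUnpair q).1.tail).2
        (boolUnpair q).2) t
    else none
  else U₀.run (boolPair (boolUnpair q).1.tail (boolUnpair q).2) t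

/-- **The s-m-n mode.** [cite: AroraBarak2009, Thm. 1.9 and §1.4.1] -/
theorem padRun_smn (e₀ ψ w : List Bool) (t : ℕ) :
    padRun U₀ (boolPair (true :: boolPair e₀ ψ) w) t =
      if clock₁ ψ w + clock₂ ψ w ≤ t then U₀.run (smnProg e₀ ψ w) t else none := by
  simp [padRun]

/-- **The plain mode.** [cite: AroraBarak2009, Thm. 1.9] -/
theorem padRun_plain (e w : List Bool) (t : ℕ) :
    padRun U₀ (boolPair (false :: e) w) t = U₀.run (boolPair e w) t := by
  simp [padRun]

/-- The padded run is monotone in the budget. [cite: AroraBarak2009, §1.4.1] -/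
theorem padRun_mono {q : List Bool} {t t' : ℕ} {y : List Bool} (h : t ≤ t')
    (hy : padRun U₀ q t = some y) : padRun U₀ q t' = some y := by
  unfold padRun at hy ⊢
  split_ifs at hy ⊢ with h1 h2 h3
  · exact U₀.run_mono h hy
  · omega
  · exact U₀.run_mono h hy

/-- Universality of the padded run: `U₀`'s code `e` of a machine becomes `0 :: e`.
[cite: AroraBarak2009, Thm. 1.9] -/
theorem padRun_sim (M : Turing.TM2ComputableAux Bool Bool) : ∃ (e : List Bool) (p : Polynomial ℕ),
    ∀ (w y : List Bool) (t : ℕ), M.OutputsWithin w y t → padRun U₀ (boolPair e w) (p.eval t) = some y := by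
  obtain ⟨e, p, h⟩ := U₀.sim M
  exact ⟨false :: e, p, fun w y t hw => by rw [padRun_plain]; exact h w y t hw⟩

/-! ### The padded run is polynomial time -/

/-- The program part `e` of the input record `⟨⟨e, w⟩, 1ᵗ⟩`. [folklore] -/
def iE : List Bool → List Bool := fstF ∘ fstF
/-- The input part `w`. [folklore] -/
def iW : List Bool → List Bool := sndF ∘ fstF
/-- The parameter `ψ` (s-m-n mode). [folklore] -/
def iPsi : List Bool → List Bool := sndF ∘ List.tail ∘ iE
/-- The machine code `e₀` (s-m-n mode). [folklore] -/
def iE₀ : List Bool → List Bool := fstF ∘ List.tail ∘ iE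
/-- The base `1^{|w|+2}` of the clocks. [folklore] -/
def iBase : List Bool → List Bool := List.cons true ∘ List.cons true ∘ onesFn ∘ iW
/-- The cap `1^{t+1}` of the clocks. [folklore] -/
def iCap : List Bool → List Bool := List.cons true ∘ sndF
/-- The first clock, capped: `1^{min (t+1) B₁}`. [folklore] -/
def iP₁ : List Bool → List Bool := powCapFn ∘ fanoutFn (fstF ∘ iPsi) (fanoutFn iBase iCap)
/-- The second clock, capped: `1^{min (t+1) B₂}`. [folklore] -/
def iP₂ : List Bool → List Bool := powCapFn ∘ fanoutFn (nthF 1 ∘ iPsi) (fanoutFn iBase iCap)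
/-- The `U₀`-program of the s-m-n mode, assembled. [folklore] -/
def iProg : List Bool → List Bool := fanoutFn iE₀ (fanoutFn iPsi (fanoutFn iW (fanoutFn iP₁ iP₂)))

/-- **The padded run as a string function** on `⟨q, 1ᵗ⟩`. [cite: AroraBarak2009, Thm. 1.9 and §1.4.1] -/
def padRunFn : List Bool → List Bool :=
  iteFn (eqPairFn ∘ fanoutFn (Complexity.take1Fn ∘ iE) (fun _ => [true]))
    (iteFn (ltLenF ∘ fanoutFn sndF (fun z => iP₁ z ++ iP₂ z)) (fun _ => [false])
      (urunFn U₀ ∘ fanoutFn iProg sndF))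
    (urunFn U₀ ∘ fanoutFn (fanoutFn (List.tail ∘ iE) iW) sndF)

/-- `iE ∈ FP`. [folklore] -/
theorem iE_mem_FP : iE ∈ FP := comp_mem_FP fstF_mem_FP fstF_mem_FP

/-- `iW ∈ FP`. [folklore] -/
theorem iW_mem_FP : iW ∈ FP := comp_mem_FP sndF_mem_FP fstF_mem_FP

/-- `iPsi ∈ FP`. [folklore] -/
theorem iPsi_mem_FP : iPsi ∈ FP :=
  comp_mem_FP sndF_mem_FP (comp_mem_FP PRelSigma.tail_mem_FP iE_mem_FP)

/-- `iE₀ ∈ FP`. [folklore] -/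
theorem iE₀_mem_FP : iE₀ ∈ FP :=
  comp_mem_FP fstF_mem_FP (comp_mem_FP PRelSigma.tail_mem_FP iE_mem_FP)

/-- `iBase ∈ FP`. [folklore] -/
theorem iBase_mem_FP : iBase ∈ FP :=
  comp_mem_FP (cons_mem_FP true) (comp_mem_FP (cons_mem_FP true) (comp_mem_FP onesFn_mem_FP iW_mem_FP))

/-- `iCap ∈ FP`. [folklore] -/
theorem iCap_mem_FP : iCap ∈ FP := comp_mem_FP (cons_mem_FP true) sndF_mem_FP

/-- `iP₁ ∈ FP`. [folklore] -/
theorem iP₁_mem_FP : iP₁ ∈ FP :=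
  comp_mem_FP powCapFn_mem_FP (fanoutFn_mem_FP (comp_mem_FP fstF_mem_FP iPsi_mem_FP)
    (fanoutFn_mem_FP iBase_mem_FP iCap_mem_FP))

/-- `iP₂ ∈ FP`. [folklore] -/
theorem iP₂_mem_FP : iP₂ ∈ FP :=
  comp_mem_FP powCapFn_mem_FP (fanoutFn_mem_FP (comp_mem_FP (nthF_mem_FP 1) iPsi_mem_FP)
    (fanoutFn_mem_FP iBase_mem_FP iCap_mem_FP))

/-- `iProg ∈ FP`. [folklore] -/
theorem iProg_mem_FP : iProg ∈ FP :=
  fanoutFn_mem_FP iE₀_mem_FP (fanoutFn_mem_FP iPsi_mem_FP (fanoutFn_mem_FP iW_mem_FP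
    (fanoutFn_mem_FP iP₁_mem_FP iP₂_mem_FP)))

/-- **`padRunFn U₀ ∈ FP`.** [cite: AroraBarak2009, Thm. 1.9 and §1.4.1] -/
theorem padRunFn_mem_FP : padRunFn U₀ ∈ FP :=
  iteFn_mem_FP (comp_mem_FP eqPairFn_mem_FP (fanoutFn_mem_FP
      (comp_mem_FP Complexity.take1Fn_mem_FP iE_mem_FP) (const_mem_FP _)))
    (iteFn_mem_FP (comp_mem_FP ltLenF_mem_FP (fanoutFn_mem_FP sndF_mem_FP
        (append_mem_FP iP₁_mem_FP iP₂_mem_FP))) (const_mem_FP _)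
      (comp_mem_FP (urunFn_mem_FP U₀) (fanoutFn_mem_FP iProg_mem_FP sndF_mem_FP)))
    (comp_mem_FP (urunFn_mem_FP U₀) (fanoutFn_mem_FP
      (fanoutFn_mem_FP (comp_mem_FP PRelSigma.tail_mem_FP iE_mem_FP) iW_mem_FP) sndF_mem_FP))

/-- Equality tests after a map are one-bit conditions. [folklore] -/
theorem oneBit_eqPairFn_comp (g : List Bool → List Bool) : OneBit (eqPairFn ∘ g) := fun z => by
  rcases eqPairFn_eq_or (g z) with h | h <;> exact ⟨_, h⟩

/-- `onesFn w = 1^{|w|}` in the `ones` spelling. [folklore] -/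
theorem onesFn_eq_ones (w : List Bool) : onesFn w = ones w.length := by
  simp [onesFn, OracleCompose.unaryEncodeNat_eq_replicate, ones]

/-- Threshold arithmetic: comparing `B₁ + B₂` with `t` through the powers capped at `t + 1`.
[folklore] -/
theorem add_le_iff_min_add_min_le (B₁ B₂ t : ℕ) :
    B₁ + B₂ ≤ t ↔ min (t + 1) B₁ + min (t + 1) B₂ ≤ t := by
  omega

/-- **Semantics of `padRunFn`**: on `⟨q, 1ᵗ⟩` it is the code of `padRun U₀ q t`.
[cite: AroraBarak2009, Thm. 1.9 and §1.4.1] -/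
theorem padRunFn_apply (q : List Bool) (t : ℕ) :
    padRunFn U₀ (boolPair q (ones t)) = encOpt (padRun U₀ q t) := by
  obtain ⟨e, w, hq⟩ : ∃ e w, boolUnpair q = (e, w) := ⟨_, _, rfl⟩
  obtain ⟨e₀, ψ, hr⟩ : ∃ a b, boolUnpair e.tail = (a, b) := ⟨_, _, rfl⟩
  have hE : iE (boolPair q (ones t)) = e := by simp [iE, fstF, hq]
  have hW : iW (boolPair q (ones t)) = w := by simp [iW, fstF, sndF, hq]
  have hPsi : iPsi (boolPair q (ones t)) = ψ := by
    simp only [iPsi, Function.comp_apply, hE, sndF, hr]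
  have hE₀ : iE₀ (boolPair q (ones t)) = e₀ := by
    simp only [iE₀, Function.comp_apply, hE, fstF, hr]
  have hT : sndF (boolPair q (ones t)) = ones t := sndF_boolPair _ _
  have hBase : iBase (boolPair q (ones t)) = ones (w.length + 2) := by
    simp [iBase, hW, onesFn_eq_ones, ones, List.replicate_succ]
  have hCap : iCap (boolPair q (ones t)) = ones (t + 1) := by
    simp [iCap, ones, List.replicate_succ]
  have hP₁ : iP₁ (boolPair q (ones t)) = ones (min (t + 1) (clock₁ ψ w)) := by
    simp only [iP₁, Function.comp_apply, fanoutFn_apply, hPsi, hBase, hCap, powCapFn_apply, clock₁]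
    rfl
  have hP₂ : iP₂ (boolPair q (ones t)) = ones (min (t + 1) (clock₂ ψ w)) := by
    simp only [iP₂, Function.comp_apply, fanoutFn_apply, hPsi, hBase, hCap, powCapFn_apply, clock₂]
    rfl
  have hProg : clock₁ ψ w + clock₂ ψ w ≤ t → iProg (boolPair q (ones t)) = smnProg e₀ ψ w := by
    intro h
    simp only [iProg, fanoutFn_apply, hE₀, hPsi, hW, hP₁, hP₂, smnProg]
    rw [min_eq_right (by omega), min_eq_right (by omega)]
  -- the outer branch
  rw [padRunFn, iteFn_of_oneBit (oneBit_eqPairFn_comp _)]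
  have hcond : (eqPairFn ∘ fanoutFn (Complexity.take1Fn ∘ iE) fun _ => [true]) (boolPair q (ones t)) =
      [decide (e.take 1 = [true])] := by
    simp only [Function.comp_apply, fanoutFn_apply, hE, Complexity.take1Fn]
    exact eqPairFn_boolPair _ _
  rw [hcond]
  unfold padRun
  rw [hq]
  dsimp only
  rw [hr]
  dsimp only
  by_cases hs : e.take 1 = [true]
  · rw [if_pos (by simp [hs]), if_pos hs, iteFn_of_oneBit (oneBit_ltLenF.comp _)]
    have hlt : (ltLenF ∘ fanoutFn sndF fun z => iP₁ z ++ iP₂ z) (boolPair q (ones t)) =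
        [decide (t < min (t + 1) (clock₁ ψ w) + min (t + 1) (clock₂ ψ w))] := by
      simp [Function.comp_apply, hP₁, hP₂, ones]
    rw [hlt]
    by_cases hb : clock₁ ψ w + clock₂ ψ w ≤ t
    · rw [if_neg (by simp; omega), if_pos hb]
      simp only [Function.comp_apply, fanoutFn_apply, hProg hb, hT, urunFn_boolPair, ones,
        List.length_replicate]
    · rw [if_pos (by simp; omega), if_neg hb]
      rfl
  · rw [if_neg (by simp [hs]), if_neg hs]
    simp only [Function.comp_apply, fanoutFn_apply, hE, hW, hT, urunFn_boolPair, ones,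
      List.length_replicate]

/-- **The polynomial-time field of the padded machine.** [cite: AroraBarak2009, Thm. 1.9 and §1.4.1] -/
theorem polyTime_padRun :
    PolyTimeComputable (fun q : List Bool × ℕ => boolPair q.1 (unaryEncodeNat q.2))
      ((encodingList Bool).optionBool).encode (Function.uncurry (padRun U₀)) := by
  obtain ⟨p, M, hM⟩ := padRunFn_mem_FP U₀
  refine ⟨p, M, fun q => ?_⟩
  have heq : padRunFn U₀ (boolPair q.1 (unaryEncodeNat q.2)) =
      ((encodingList Bool).optionBool).encode (Function.uncurry (padRun U₀) q) := by
    rw [OracleCompose.unaryEncodeNat_eq_replicate]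
    exact padRunFn_apply U₀ q.1 q.2
  have h := hM (boolPair q.1 (unaryEncodeNat q.2))
  simp only [id] at h
  rw [heq] at h
  exact h

/-! ### The padded universal machine -/

/-- **The padded universal machine** `padUM U₀`: the padded run, monotone, polynomial time,
universal (plain mode), with cheap printing programs (`print_of_sim`).
[cite: AroraBarak2009, Thm. 1.9 and §1.4.1] -/
def padUM : UniversalMachine where
  run := padRun U₀
  run_mono := fun h hy => padRun_mono U₀ h hy
  polyTime := polyTime_padRun U₀
  sim := padRun_sim U₀
  print := UniversalMachine.print_of_sim (fun h hy => padRun_mono U₀ h hy) (padRun_sim U₀)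

/-- The run of `padUM U₀` is `padRun U₀`. [folklore] -/
@[simp] theorem padUM_run : (padUM U₀).run = padRun U₀ := rfl

/-- **The s-m-n mode of `padUM U₀`, with enough budget**: the padded machine runs `U₀` on
`⟨e₀, ⟨ψ, ⟨w, ⟨1^{B₁}, 1^{B₂}⟩⟩⟩⟩`. [cite: AroraBarak2009, Thm. 1.9 and §1.4.1] -/
theorem padUM_run_smn {e₀ ψ w : List Bool} {t : ℕ} (ht : clock₁ ψ w + clock₂ ψ w ≤ t) :
    (padUM U₀).run (boolPair (true :: boolPair e₀ ψ) w) t = U₀.run (smnProg e₀ ψ w) t := by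
  rw [padUM_run, padRun_smn, if_pos ht]

end PaddedUM

end Literature.Computability.MetaComplexity
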